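import Summits.AtomisticToContinuum.BoseEinsteinCondensation.Theorems.BECGroundStateSOSPeriodicIRBoundPFOpNorm
import Summits.AtomisticToContinuum.BoseEinsteinCondensation.Theorems.BECGroundStateSOSPeriodicIRBoundPFTruncFamily
import HarnessLib

/-!
# Crux `PeriodicIRBound` (stmt-AtomisticToContinuum-3972), line `linear-ph-floor-wagner` — the operator norm
# of the torus Feynman–Kac semigroup of a GENERAL measurable integrable profile: `‖e^{-tH_v}‖ ≤ e^{-tE₀(v)}`

Helper file of the line lead (seat c2), sequel of `…PFOpNorm.lean` (finite-range profiles) and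
`…PFTruncFamily.lean`. For a measurable profile `v` with `∫ v(|x|)dx < ∞` but possibly INFINITE range the
height truncations `min(v, n)` need not have bounded periodisations, so we truncate height AND range:
`wₙ = 1_{[0,n]} · min(v, n)` is admissible of finite range and bounded (`isRepulsiveFiniteRange_cutTrunc`), increases
to `v` pointwise (`monotone_cutTrunc`, `iSup_cutTrunc`), its semigroup has norm `e^{-tE₀(wₙ)}`
(`opNorm_pfkL2_cutTrunc`, the tree's Perron–Frobenius package), dominates that of `v`
(`opNorm_pfkL2_anti_potential`), and `E₀(wₙ) ↑ E₀(v)` (`iSup_periodicGroundStateEnergy_family`); whence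
**`opNorm_pfkL2_le_exp_of_integrable`**: `‖e^{-tH_v}‖ ≤ e^{-tE₀(v)}` on `L²(cell)` for `N ≥ 1`, `t, L > 0`.

References: Reed–Simon IV §XIII.12 (Thm XIII.44), Thm XIII.64; Chung–Zhao (1995) Thm 3.10.
-/

noncomputable section

open scoped BigOperators ENNReal NNReal InnerProductSpace Topology
open Filter MeasureTheory

namespace Summit.AtomisticToContinuum.BoseEinsteinCondensation.Cruxes.PeriodicIRBound.LinearPhFloorWagner

open Literature.MathematicalPhysics.QuantumManyBody
open Literature.MathematicalPhysics.QuantumManyBody.BoseGas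
open Summit.AtomisticToContinuum.BoseEinsteinCondensation.Cruxes.HardCoreExtension.ThirdLawCurrentFloor
  (exists_periodizedPotential_le)

variable {N : ℕ}

/-! ## §1 The height-and-range truncations `1_{[0,n]}·min(v,n)` -/

/-- The truncations are measurable. [folklore] -/
theorem measurable_cutTrunc {v : ℝ → ℝ≥0∞} (hv : Measurable v) (n : ℕ) :
    Measurable fun r => Set.indicator (Set.Iic (n : ℝ)) (truncPotential v n) r :=
  (measurable_truncPotential hv n).indicator measurableSet_Iic

/-- The truncations lie below the profile. [folklore] -/
theorem cutTrunc_le (v : ℝ → ℝ≥0∞) (n : ℕ) (r : ℝ) :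
    Set.indicator (Set.Iic (n : ℝ)) (truncPotential v n) r ≤ v r := by
  by_cases hr : r ∈ Set.Iic (n : ℝ)
  · rw [Set.indicator_of_mem hr]; exact truncPotential_le v n r
  · rw [Set.indicator_of_notMem hr]; exact bot_le

/-- The truncations increase with `n`. [folklore] -/
theorem monotone_cutTrunc (v : ℝ → ℝ≥0∞) (r : ℝ) :
    Monotone fun n : ℕ => Set.indicator (Set.Iic (n : ℝ)) (truncPotential v n) r := by
  intro n n' h
  dsimp only
  by_cases hr : r ∈ Set.Iic (n : ℝ)
  · have hr' : r ∈ Set.Iic (n' : ℝ) := le_trans (Set.mem_Iic.1 hr) (by exact_mod_cast h)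
    rw [Set.indicator_of_mem hr, Set.indicator_of_mem hr']
    exact monotone_truncPotential v r h
  · rw [Set.indicator_of_notMem hr]; exact bot_le

/-- The truncations increase TO the profile pointwise. [folklore] -/
theorem iSup_cutTrunc (v : ℝ → ℝ≥0∞) (r : ℝ) :
    ⨆ n : ℕ, Set.indicator (Set.Iic (n : ℝ)) (truncPotential v n) r = v r := by
  refine le_antisymm (iSup_le fun n => cutTrunc_le v n r) ?_
  rw [← iSup_truncPotential v r]
  refine iSup_le fun n => ?_
  set m : ℕ := max n ⌈r⌉₊ with hm
  have hrm : r ∈ Set.Iic (m : ℝ) := by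
    rw [Set.mem_Iic, hm, Nat.cast_max]
    exact le_trans (Nat.le_ceil r) (le_max_right _ _)
  calc truncPotential v n r ≤ truncPotential v m r := monotone_truncPotential v r (le_max_left _ _)
    _ = Set.indicator (Set.Iic (m : ℝ)) (truncPotential v m) r := (Set.indicator_of_mem hrm _).symm
    _ ≤ ⨆ k : ℕ, Set.indicator (Set.Iic (k : ℝ)) (truncPotential v k) r :=
        le_iSup (fun k : ℕ => Set.indicator (Set.Iic (k : ℝ)) (truncPotential v k) r) m

/-- The truncations are admissible (measurable, finite range `n`) — even when `v` has infinite range. [folklore] -/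
theorem isRepulsiveFiniteRange_cutTrunc {v : ℝ → ℝ≥0∞} (hv : Measurable v) (n : ℕ) :
    IsRepulsiveFiniteRange fun r => Set.indicator (Set.Iic (n : ℝ)) (truncPotential v n) r :=
  ⟨measurable_cutTrunc hv n, n, fun r hr => Set.indicator_of_notMem (by simpa using hr) _⟩

/-- **`‖e^{-tH_{wₙ}}‖ = e^{-tE₀(wₙ)}`** for the height-and-range truncations (`N ≥ 1`, `t, L > 0`): the tree's
Perron–Frobenius package on a bounded periodisation. [cite: ReedSimonIV1978, Thm XIII.44] -/
theorem opNorm_pfkL2_cutTrunc {v : ℝ → ℝ≥0∞} (hv : Measurable v) (hN : 1 ≤ N) {L : ℝ} (hL : 0 < L) (n : ℕ)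
    {t : ℝ} (ht : 0 < t) :
    ‖(pfkL2 (fun r => Set.indicator (Set.Iic (n : ℝ)) (truncPotential v n) r) L t :
        Lp ℝ 2 (volume.restrict (cellN N L)) →L[ℝ] _)‖ =
      Real.exp (-((periodicGroundStateEnergy (fun r => Set.indicator (Set.Iic (n : ℝ)) (truncPotential v n) r)
        N L).toReal * t)) := by
  have hw := isRepulsiveFiniteRange_cutTrunc hv n
  have hM : ∃ M : ℝ≥0∞, M ≠ ⊤ ∧ ∀ r, Set.indicator (Set.Iic (n : ℝ)) (truncPotential v n) r ≤ M :=
    ⟨n, ENNReal.natCast_ne_top n, fun r => (Set.indicator_le_self _ _ r).trans (min_le_right _ _)⟩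
  obtain ⟨C, hC⟩ := exists_periodizedPotential_le hw hM hL
  obtain ⟨Ψ₀, hΨ₀, -, -⟩ := PeriodicGroundStateFeynmanKac_holds N L _ hN hL hw.1 ⟨C, hC⟩
  exact (hΨ₀.opNorm_pfkL2 hw.1 hL hC ht).1

/-! ## §2 The operator norm for a general integrable profile -/

/-- **`‖e^{-tH_v}‖ ≤ e^{-tE₀(v)}` on `L²(cell)` for every MEASURABLE profile with `∫ v(|x|)dx < ∞`** (`N ≥ 1`,
`t, L > 0`; infinite range and unbounded periodisation allowed): domination by the height-and-range
truncations, their Perron–Frobenius norms, and the monotone form limit `E₀(wₙ) ↑ E₀(v)`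
(`iSup_periodicGroundStateEnergy_family`). [cite: ReedSimonIV1978, Thm XIII.44] -/
theorem opNorm_pfkL2_le_exp_of_integrable {v : ℝ → ℝ≥0∞} (hv : Measurable v) (hint : (∫⁻ x : Space, v ‖x‖) ≠ ⊤)
    (hN : 1 ≤ N) {L : ℝ} (hL : 0 < L) {t : ℝ} (ht : 0 < t) :
    ‖(pfkL2 v L t : Lp ℝ 2 (volume.restrict (cellN N L)) →L[ℝ] _)‖ ≤
      Real.exp (-((periodicGroundStateEnergy v N L).toReal * t)) := by
  have hW := WF.lintegral_cellN_periodicInteraction_ne_top hL hv hint N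
  set w : ℕ → ℝ → ℝ≥0∞ := fun n r => Set.indicator (Set.Iic (n : ℝ)) (truncPotential v n) r with hwdef
  set E : ℕ → ℝ≥0∞ := fun n => periodicGroundStateEnergy (w n) N L with hEdef
  have hle : ∀ n, ‖(pfkL2 v L t : Lp ℝ 2 (volume.restrict (cellN N L)) →L[ℝ] _)‖ ≤
      Real.exp (-((E n).toReal * t)) := fun n => by
    rw [hEdef]
    dsimp only
    rw [hwdef, ← opNorm_pfkL2_cutTrunc hv hN hL n ht]
    exact opNorm_pfkL2_anti_potential (measurable_cutTrunc hv n) hv (cutTrunc_le v n) hL ht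
  have hfin := periodicGroundStateEnergy_ne_top_of_integrable hv hN hL hW
  have hsup := iSup_periodicGroundStateEnergy_family (w := w) hv hN hL hW (measurable_cutTrunc hv)
    (monotone_cutTrunc v) (iSup_cutTrunc v)
  have htend : Tendsto (fun n => (E n).toReal) atTop (𝓝 (periodicGroundStateEnergy v N L).toReal) := by
    have h1 : Tendsto E atTop (𝓝 (⨆ n, E n)) :=
      tendsto_atTop_iSup (monotone_periodicGroundStateEnergy_family (monotone_cutTrunc v) N L)
    rw [hEdef] at h1 ⊢
    simp only at h1
    rw [hsup] at h1
    exact (ENNReal.tendsto_toReal hfin).comp h1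
  have hcont : Tendsto (fun n => Real.exp (-((E n).toReal * t))) atTop
      (𝓝 (Real.exp (-((periodicGroundStateEnergy v N L).toReal * t)))) :=
    (Real.continuous_exp.tendsto _).comp ((htend.mul_const t).neg)
  exact ge_of_tendsto' hcont hle

/-- **Registered sub-goal `stub_pfOpNormGeneral` of the crux item** (line `linear-ph-floor-wagner`, seat c2): `opNorm_pfkL2_le_exp_of_integrable`.
[cite: ReedSimonIV1978, §XIII.12 Thm XIII.44] -/
theorem stub_pfOpNormGeneral :
    ∀ {N : ℕ} {v : ℝ → ℝ≥0∞}, Measurable v → (∫⁻ x : Space, v ‖x‖) ≠ ⊤ → 1 ≤ N → ∀ {L : ℝ}, 0 < L → ∀ {t : ℝ}, 0 < t → ‖(pfkL2 v L t : Lp ℝ 2 (volume.restrict (cellN N L)) →L[ℝ] Lp ℝ 2 (volume.restrict (cellN N L)))‖ ≤ Real.exp (-((periodicGroundStateEnergy v N L).toReal * t)) :=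
  fun hv hint hN _ hL _ ht => opNorm_pfkL2_le_exp_of_integrable hv hint hN hL ht

end Summit.AtomisticToContinuum.BoseEinsteinCondensation.Cruxes.PeriodicIRBound.LinearPhFloorWagner

end
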